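import Summits.BirchSwinnertonDyer.BirchSwinnertonDyer.Theses.PlecticLegs
import Literature.NumberTheory.EllipticCurves.Selmer
import Literature.NumberTheory.EllipticCurves.GaloisAction
import HarnessLib

/-!
# Line `selmer-ladder` for crux `PlecticLegs.PlecticPointsLB` (stmt-BirchSwinnertonDyer-17518)

Skeleton registered by the crux-strategist seat `cstrat-stmt-BirchSwinnertonDyer-17518-b1` (2026-08-17,
BEFORE any lead is seated; judge attack axis 2.0). Card: `Lines/selmer_ladder.md`; census:
`STRATEGY-CENSUS.md` (same directory). Slug `selmer-ladder` (the workfile store renames `-` to `_`).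

## The crux (recall)

`PlecticPointsLB : ∀ F` totally real, `d = [F:ℚ] ≥ 2`, `∀ V/F` elliptic, `r_an(V/F) = d → d ≤ rank_ℤ V(F)`
— the LOWER-BOUND half of BSD over a totally real field in the plectic regime (order of vanishing = number
of real places). Nothing in print gives `rank ≥ 2` from analytic data over any number field (six grounder
logs, refuter birth attack 2026-08-17: survives, non-vacuous, no finite certified falsifier).

## The line: Eisenstein-congruence first class + Nekovář parity + p-converse ladder + Ш-cotorsion at ONE prime

The only engines that turn VANISHING of `L(V/F, s)` into ARITHMETIC over a totally real `F` act on the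
`p^∞`-Selmer group, and in the plectic regime they stack into a ladder.  Fix an ADMISSIBLE prime `p` for
`(F, V)`: `5 ≤ p`, `p ∤ disc F` (unramified), `ρ̄_{V,p}` irreducible (NOT "surjective": CM curves must keep
admissible primes — negatives index, `LeadingTerm.TamePinch`), and good ORDINARY reduction at every `𝔭 ∣ p`
(read off Mathlib's local polynomial `1 − a_𝔭T + N𝔭·T²` of the minimal model at `𝔭`: degree `2` and
`p ∤ a_𝔭`).  Write `s_p = corank_{ℤ_p} Sel_{p^∞}(V/F)` (`WeierstrassCurve.selmerCorank`).

* **A · `stub_firstZero` — first-order vanishing gives one Selmer class.** `r_an(V/F) ≥ 1 ⇒ s_p ≥ 1`.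
  In print for MODULAR `V` (Hilbert newform of parallel weight 2): X. Wan, Forum Math. Sigma 3 (2015) e18,
  Thm 7 (pp. 5–6: `p` odd unramified in `F`, good ordinary above `p`, (irred); hypothesis (iii) is void here
  because it only bites when the sign is `−1` AND `[F:ℚ]` is even; Conjecture 6 is known in weight 2 by
  Nekovář, Canad. J. Math. 64 (2012) Thm B) — the Skinner–Urban Eisenstein-congruence method on `U(2,2)/F`.
  Over `ℚ`: Skinner–Urban 2014; Burungale–Castella–Skinner 2025 Thm 1.1.2 (tree: SelmerRank route notes).
  Modularity of `V/F` is a PROOF-LEVEL input of this stub: known for `[F:ℚ] = 2` (Freitas–Le Hung–Siksek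
  2015), `3` (Derickx–Najman–Siksek 2020), and for every base change `E_F` of `E/ℚ` to an abelian totally
  real `F` (Langlands 1980, cyclic base change) — i.e. on EVERY instance the route's `closes` feeds in.
* **B · `stub_parity` — `p`-parity over totally real fields.** `s_p ≡ r_an(V/F) (mod 2)`.  In print WITHOUT
  modularity: Nekovář, Algebra Number Theory 7 (2013) Thm A (all `E` over totally real `F`, all `p`, except CM
  with `2 ∣ [F:ℚ]` and `p` non-split in the CM field — excluded here: ordinary above `p` forces `p` split in the
  CM field); `r_an` there is defined through potential modularity (Wintenberger's appendix to Nekovář 2009) and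
  agrees with the tree's `analyticRank` whenever `L(V/F,s)` is entire, which `1 ≤ analyticRank` forces.
* **C · `stub_ladder` — no intermediate corank: the `p`-CONVERSE in coranks `1 ≤ k ≤ [F:ℚ] − 2`.**
  `s_p = k ∧ r_an ≥ 1 ⇒ r_an = k`.  For `k = 1` (needed from `d = 3` on) this is the rank-one `p`-converse to
  Gross–Zagier–Kolyvagin OVER `F` — over `ℚ` a theorem (Skinner 2020; W. Zhang 2014; Wan arXiv:1408.4043;
  Burungale–Castella–Grossi–Skinner), over totally real `F` NEAR print (ingredients: Liu–Zhang–Zhang `p`-adic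
  Waldspurger 2018, Wan 2015, Longo 2012 / Fouquet 2013 anticyclotomic divisibility, Yuan–Zhang–Zhang GZ on
  Shimura curves, Nekovář's Kolyvagin over `F`) but not located as a stated theorem; for `k ≥ 2` (needed from
  `d = 4` on) it is OPEN — the same frontier as `SelmerRank.SelmerRankLB` over `ℚ` ("open from `r_an = 4`",
  first case corank `2` vs order `4`).  THIS is the stub where the line is expected to stall, sharply.
* **D · `stub_points` — Selmer corank realised by points at ONE admissible prime (Ш[p^∞]-cotorsion in the
  plectic regime).** `r_an(V/F) = d ≥ 2 ⇒ ∃` admissible `p`, `s_p ≤ rank_ℤ V(F)`.  By the corank identity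
  (tree fact `WeierstrassCurve.selmerCorank_eq_mordellWeilRank_add`) this is `corank Ш(V/F)[p^∞] = 0` at one
  prime (`Barriers…shaCorank_eq_zero_iff_selmerCorank_le`): the Selmer-versus-Mordell–Weil WALL
  (`Literature.Barriers.BirchSwinnertonDyer.SelmerRankBarrier`, narrow form), open for every curve of analytic
  rank `≥ 2` over every number field; it also carries the (true, Serre-density) existence of admissible primes.
  It is where any POINT construction (plectic Heegner classes, Fornea 2026 Conj. 1.10; mock plectic points,
  Darmon–Fornea 2025 Conj. 3.10) would have to land.

`PlecticPointsLB_of` (sorry-free): D supplies `p` and `s_p ≤ rank`; A gives `s_p ≥ 1`; C at `k = s_p`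
excludes `1 ≤ s_p ≤ d − 2` (else `r_an = s_p < d`); so `s_p ≥ d − 1`, and B (`s_p ≡ d`) excludes `d − 1`;
hence `d ≤ s_p ≤ rank`.  Every stub is used; `omega` does the arithmetic.

What the language switch buys, honestly: at SELMER level the plectic regime `d = 2, 3` is COVERED by printed
engines (A+B, resp. A+B+C₁) for modular `V` — in particular for every silent base change the route uses —
whereas `d ≥ 4` meets the universal "corank 2 versus order 4" frontier (stub C, `k ≥ 2`), and the passage from
classes to points (stub D) is the summit's own wall at every `d`.  The line does not pretend otherwise: it
isolates the two open pieces as C (`k ≥ 2`) and D, states A, B, C₁ in the exact shape of the printed theorems,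
and proves the glue.

Disproof.lean: none exists for this crux (no cdisprove seat has run; payload.disproof_path absent 2026-08-17)
— nothing to honour.  Negatives index (BSD): 1 entry (`LeadingTerm.TamePinch`: CM curves have no prime with
SURJECTIVE `ρ̄`) — answered: admissibility asks only IRREDUCIBLE `ρ̄_{V,p}` and ordinarity, both available at
infinitely many `p` for CM curves (`p` split in the CM field) and for non-CM curves (Serre).

Sorries: exactly four, one inside each `stub_*`; zero elsewhere.  Stub statements are fully EXPANDED over tree /
Mathlib declarations (no local abbreviation inside a stub), so that a future route-level split can file them
verbatim as items.
-/

set_option linter.dupNamespace false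
set_option linter.unusedVariables false

open NumberField IsDedekindDomain

namespace Summit.BirchSwinnertonDyer.BirchSwinnertonDyer.Cruxes.PlecticPointsLB.SelmerLadder

open Summit.BirchSwinnertonDyer.BirchSwinnertonDyer.Theses.PlecticLegs

/-! ## Admissible primes (documentation only — the stubs below expand this predicate inline) -/

/-- `GoodOrdinaryAbove F V p`: at every prime `𝔭` of `𝓞_F` above `p`, the local polynomial of (the minimal
model of) `V` at `𝔭` — Mathlib's `WeierstrassCurve.localPolynomial`, `1 − a_𝔭 T + N𝔭·T²` in the good case,
`1 ∓ T` multiplicative, `1` additive — has degree `2` (GOOD reduction) and `p ∤ a_𝔭 = −coeff 1` (ORDINARY).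
This `def` is NOT used in the stubs (they expand it); it documents the predicate. [folklore] -/
def GoodOrdinaryAbove (F : Type) [Field F] [NumberField F] (V : WeierstrassCurve F) (p : ℕ) : Prop :=
  ∀ 𝔭 : HeightOneSpectrum (𝓞 F), (p : 𝓞 F) ∈ 𝔭.asIdeal →
    ((V.baseChange (𝔭.adicCompletion F)).localPolynomial (𝔭.adicCompletionIntegers F)).natDegree = 2 ∧
    ¬ (p : ℤ) ∣ ((V.baseChange (𝔭.adicCompletion F)).localPolynomial (𝔭.adicCompletionIntegers F)).coeff 1

/-! ## The four registered stubs -/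

/-- **A · `stub_firstZero` — first-order vanishing gives one Selmer class (Eisenstein congruences on
`U(2,2)/F`).** For `F` totally real, `V/F` elliptic and an admissible prime `p` (`5 ≤ p`, `p ∤ disc F`,
`ρ̄_{V,p}` irreducible, good ordinary above `p`): `1 ≤ ord_{s=1} L(V/F,s) ⇒ 1 ≤ corank_{ℤ_p} Sel_{p^∞}(V/F)`.
In print for modular `V`: Wan 2015 Thm 7 (with Nekovář 2012 Thm B for his Conjecture 6 in weight 2);
`F = ℚ`: Skinner–Urban 2014 / Burungale–Castella–Skinner 2025 Thm 1.1.2. Proof-level input not in the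
binders: modularity of `V/F` (known for `[F:ℚ] ≤ 3` and for abelian base changes from `ℚ`). Why it might
fail as typed: only through the modularity gap for `[F:ℚ] ≥ 4` non-base-change `V` (statement still expected
true), or a mismatch between Wan's Selmer group `H¹_f(F, ρ*_f)` and the tree's `selmerGroupPInfty` (same
group for good ordinary `p`: Greenberg = Bloch–Kato). Size XL.
[cite: doi:10.1017/fms.2015.16, Thm 7] [cite: doi:10.2140/ant.2013.7.1101, Thm A] -/
theorem stub_firstZero :
    ∀ (F : Type) [Field F] [NumberField F] [NumberField.IsTotallyReal F] (V : WeierstrassCurve F)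
      [V.IsElliptic] (p : ℕ) [Fact p.Prime], 5 ≤ p → ¬ ((p : ℤ) ∣ NumberField.discr F) →
      V.HasIrreducibleModPGaloisRep p →
      (∀ 𝔭 : HeightOneSpectrum (𝓞 F), (p : 𝓞 F) ∈ 𝔭.asIdeal →
        ((V.baseChange (𝔭.adicCompletion F)).localPolynomial (𝔭.adicCompletionIntegers F)).natDegree = 2 ∧
        ¬ (p : ℤ) ∣ ((V.baseChange (𝔭.adicCompletion F)).localPolynomial
          (𝔭.adicCompletionIntegers F)).coeff 1) →
      1 ≤ V.analyticRank → 1 ≤ V.selmerCorank p := by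
  sorry

/-- **B · `stub_parity` — the `p`-parity theorem over totally real fields.** Same binders:
`corank_{ℤ_p} Sel_{p^∞}(V/F) ≡ ord_{s=1} L(V/F,s) (mod 2)` when `ord ≥ 1` (the guard only excludes the
junk value `analyticRank = 0` of a non-continued `L`). In print WITHOUT modularity: Nekovář 2013 Thm A
(non-CM: every `p`; CM: `p` split in the CM field, which ordinarity above `p` forces). Why it might fail as
typed: only via the identification of Nekovář's `s_p(E/F) = rk + cork Ш[p^∞]` with the tree's
`selmerCorank` (the corank identity, tree fact `selmerCorank_eq_mordellWeilRank_add`, and the `zpCorank`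
formula on a cofinitely generated group). Size XL (formalising Nekovář) / S given the printed theorem as a fact.
[cite: doi:10.2140/ant.2013.7.1101, Thm A] [cite: doi:10.1112/s0010437x09003959, Thm 1] -/
theorem stub_parity :
    ∀ (F : Type) [Field F] [NumberField F] [NumberField.IsTotallyReal F] (V : WeierstrassCurve F)
      [V.IsElliptic] (p : ℕ) [Fact p.Prime], 5 ≤ p → ¬ ((p : ℤ) ∣ NumberField.discr F) →
      V.HasIrreducibleModPGaloisRep p →
      (∀ 𝔭 : HeightOneSpectrum (𝓞 F), (p : 𝓞 F) ∈ 𝔭.asIdeal →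
        ((V.baseChange (𝔭.adicCompletion F)).localPolynomial (𝔭.adicCompletionIntegers F)).natDegree = 2 ∧
        ¬ (p : ℤ) ∣ ((V.baseChange (𝔭.adicCompletion F)).localPolynomial
          (𝔭.adicCompletionIntegers F)).coeff 1) →
      1 ≤ V.analyticRank → V.selmerCorank p % 2 = V.analyticRank % 2 := by
  sorry

/-- **C · `stub_ladder` — no intermediate Selmer corank: the `p`-converse in coranks `1 ≤ k ≤ [F:ℚ] − 2`.**
Same binders: if `corank_{ℤ_p} Sel_{p^∞}(V/F) = k` with `1 ≤ k ≤ [F:ℚ] − 2` and `ord_{s=1} L(V/F,s) ≥ 1`,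
then `ord_{s=1} L(V/F,s) = k`. `k = 1` = the rank-one `p`-converse to Gross–Zagier–Kolyvagin over `F`
(over `ℚ`: Skinner 2020, W. Zhang 2014, Wan arXiv:1408.4043; over totally real `F`: near print — Liu–Zhang–Zhang
`p`-adic Waldspurger, Wan 2015, Longo/Fouquet anticyclotomic divisibility, Yuan–Zhang–Zhang, Nekovář's
Kolyvagin — not located as a stated theorem); `k ≥ 2` (from `[F:ℚ] = 4` on) is OPEN: the rank-`k`
`p`-converse, the same frontier as `SelmerRank.SelmerRankLB` over `ℚ`. Why it might fail: for `k ≥ 2` no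
Euler/Kolyvagin system certifies "corank exactly `k` ⇒ order exactly `k`" (generalised Kato classes reach
`k = 2` only in the direction class ≠ 0 ⇒ dim Sel = 2, Castella–Hsieh 2022); true iff `p^∞`-Selmer BSD holds
in these coranks. Size: open-problem (k ≥ 2), XL (k = 1).
[cite: doi:10.4007/annals.2020.191.2.1] [cite: doi:10.4310/cjm.2014.v2.n2.a2] [cite: arXiv:1408.4043] -/
theorem stub_ladder :
    ∀ (F : Type) [Field F] [NumberField F] [NumberField.IsTotallyReal F] (V : WeierstrassCurve F)
      [V.IsElliptic] (p : ℕ) [Fact p.Prime], 5 ≤ p → ¬ ((p : ℤ) ∣ NumberField.discr F) →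
      V.HasIrreducibleModPGaloisRep p →
      (∀ 𝔭 : HeightOneSpectrum (𝓞 F), (p : 𝓞 F) ∈ 𝔭.asIdeal →
        ((V.baseChange (𝔭.adicCompletion F)).localPolynomial (𝔭.adicCompletionIntegers F)).natDegree = 2 ∧
        ¬ (p : ℤ) ∣ ((V.baseChange (𝔭.adicCompletion F)).localPolynomial
          (𝔭.adicCompletionIntegers F)).coeff 1) →
      ∀ k : ℕ, 1 ≤ k → k + 2 ≤ Module.finrank ℚ F → 1 ≤ V.analyticRank →
        V.selmerCorank p = k → V.analyticRank = k := by
  sorry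

/-- **D · `stub_points` — in the plectic regime the Selmer corank is realised by points at ONE admissible
prime (Ш[p^∞]-cotorsion).** For `F` totally real of degree `d ≥ 2` and `V/F` elliptic with
`ord_{s=1} L(V/F,s) = d`: there is an admissible prime `p` (`5 ≤ p`, `p ∤ disc F`, `ρ̄_{V,p}` irreducible, good
ordinary above `p`) with `corank_{ℤ_p} Sel_{p^∞}(V/F) ≤ rank_ℤ V(F)` — equivalently (corank identity, tree fact
`WeierstrassCurve.selmerCorank_eq_mordellWeilRank_add`) `corank Ш(V/F)[p^∞] = 0`. This is the
Selmer-versus-Mordell–Weil wall (`Literature.Barriers.BirchSwinnertonDyer.SelmerRankBarrier`, narrow form: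
"an input realising the Selmer corank by rational points"), OPEN for every curve of analytic rank `≥ 2` over
every number field; the existence of admissible primes (Serre density; CM: `p` split in the CM field) rides
with it. It is the receptacle for any point construction — plectic Heegner classes (Fornea 2026, Conj. 1.10:
`κ = det(w)`, `w ∈ ∧^r A(L_c)^χ`), mock plectic points (Darmon–Fornea 2025 Conj. 3.10), archimedean plectic
points (Fornea arXiv:2305.01130 Conj. 6.10). Why it might fail: it does not fail if BSD holds over `F`; what
fails is every known METHOD (no algorithm separates `E(K)/p^n` from `Ш[p^n]`, Silverman AEC X.§4). Size:
open-problem. [cite: arXiv:2603.28327, Conj. 1.9–1.10] [cite: arXiv:2310.16758, Conj. 3.10]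
[cite: WZhang2014, p. 193] -/
theorem stub_points :
    ∀ (F : Type) [Field F] [NumberField F] [NumberField.IsTotallyReal F] (V : WeierstrassCurve F)
      [V.IsElliptic], 2 ≤ Module.finrank ℚ F → V.analyticRank = Module.finrank ℚ F →
      ∃ (p : ℕ) (_ : Fact p.Prime), 5 ≤ p ∧ ¬ ((p : ℤ) ∣ NumberField.discr F) ∧
        V.HasIrreducibleModPGaloisRep p ∧
        (∀ 𝔭 : HeightOneSpectrum (𝓞 F), (p : 𝓞 F) ∈ 𝔭.asIdeal →
          ((V.baseChange (𝔭.adicCompletion F)).localPolynomial (𝔭.adicCompletionIntegers F)).natDegree = 2 ∧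
          ¬ (p : ℤ) ∣ ((V.baseChange (𝔭.adicCompletion F)).localPolynomial
            (𝔭.adicCompletionIntegers F)).coeff 1) ∧
        V.selmerCorank p ≤ V.mordellWeilRank := by
  sorry

/-! ## Stub statements by name -/

namespace Statement

/-- Statement of `stub_firstZero`. -/
abbrev stub_firstZero : Prop := type_of% @SelmerLadder.stub_firstZero
/-- Statement of `stub_parity`. -/
abbrev stub_parity : Prop := type_of% @SelmerLadder.stub_parity
/-- Statement of `stub_ladder`. -/
abbrev stub_ladder : Prop := type_of% @SelmerLadder.stub_ladder
/-- Statement of `stub_points`. -/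
abbrev stub_points : Prop := type_of% @SelmerLadder.stub_points

end Statement

/-! ## The composition (sorry-free) -/

/-- **`PlecticPointsLB_of`** — the four stub STATEMENTS imply the crux `PlecticLegs.PlecticPointsLB`, BY NAME.
Given `F` (degree `d ≥ 2`) and `V` with `r_an = d`: D supplies an admissible `p` with `s_p ≤ rank`; A gives
`1 ≤ s_p`; if `s_p < d` then C at `k = s_p` forces `s_p = d − 1` (any `1 ≤ s_p ≤ d − 2` would give
`r_an = s_p < d`), and B (`s_p ≡ r_an = d (mod 2)`) contradicts `s_p = d − 1`; so `d ≤ s_p ≤ rank`.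
Axioms: propext, Classical.choice, Quot.sound. -/
theorem PlecticPointsLB_of (hA : Statement.stub_firstZero) (hB : Statement.stub_parity)
    (hC : Statement.stub_ladder) (hD : Statement.stub_points) : PlecticPointsLB := by
  intro F _ _ _ V _ hd hran
  obtain ⟨p, hp, h5, hdisc, hirr, hord, hpts⟩ := hD F V hd hran
  haveI := hp
  have hpos : 1 ≤ V.analyticRank := by omega
  have h1 : 1 ≤ V.selmerCorank p := hA F V p h5 hdisc hirr hord hpos
  have h2 : V.selmerCorank p % 2 = V.analyticRank % 2 := hB F V p h5 hdisc hirr hord hpos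
  have h3 : Module.finrank ℚ F ≤ V.selmerCorank p := by
    by_contra hlt
    push Not at hlt
    have hc : V.selmerCorank p = Module.finrank ℚ F - 1 := by
      by_contra hne
      have hk := hC F V p h5 hdisc hirr hord (V.selmerCorank p) h1 (by omega) hpos rfl
      omega
    rw [hran, hc] at h2
    omega
  exact h3.trans hpts

/-- The crux along this line, MODULO the four registered stubs. -/
theorem PlecticPointsLB_proof : PlecticPointsLB :=
  PlecticPointsLB_of stub_firstZero stub_parity stub_ladder stub_points

/-- Restated with the crux's full name (documentation). -/
example : Summit.BirchSwinnertonDyer.BirchSwinnertonDyer.Theses.PlecticLegs.PlecticPointsLB :=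
  PlecticPointsLB_proof

end Summit.BirchSwinnertonDyer.BirchSwinnertonDyer.Cruxes.PlecticPointsLB.SelmerLadder
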